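import Literature.MathematicalPhysics.QuantumFieldTheory.Balaban1983to89.B9SupplySockB9P3ZdAllLettersZd
import Literature.MathematicalPhysics.QuantumFieldTheory.Balaban1983to89.B8CubeMemberLevelSep

/-!
# `Balaban1983to89.B9Eq316AveragingTransposeZdLevelZero` — [Balaban1985BackgroundPropagators] (3.16) p. 393, EDITION P₀ of the genuine averaging
# letter `Q*aQ` (`QQZdP`, companions `B9Eq316AveragingTransposeZd` ∕ `…Printed` ∕ `…Linear`): THE LEVEL `j = 0` CARRIES NO BOX — the class law, the
# averaging binder `AvgAtP` ∕ `AvgAtγ` and the ℝ-linearity of the letter with the box clause «box ⊂ Ω_{j−1}» asked at the levels `j ≥ 1` ONLY, and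
# PRINT'S constraint-bond class of the cube member, `cubeLamBP` (crossing bonds INCLUDED), shown to obey it

statement-level skeleton of published theorems with citation tags; proofs where landed; nothing here is a claim about the
Yang–Mills mass gap

`[Balaban1985BackgroundPropagators]` ("B9", CMP **99** (1985) 389–434) p. 393 (3.16) «⟨A, Q*aQA⟩ = Σ_j a Σ_{b∈Λ_j} (Lʲη)^{d−2}|(Q_j(U)A)(b)|²» — the
level `j = 0` term is `a Σ_{b∈Λ₀} η^{d−2}|A(b)|²`: NO averaging; `[Balaban1985Averaging]` ("B7" = B9's [5]) (127) p. 37 «Q₀(U₀, ηA) = ηA» (the tree: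
`B7Prop4GeneralLevels.linCovIter_zero`, `rfl`); `[Balaban1985RegularSpaces]` ("B8") (1.31) p. 82 (the boxes `Bʲ(c₋) ∪ Bʲ(c₊)` of the averaging at
the levels `j ≥ 1`), p. 77 (bond convention: a bond belongs to `Ω` when one end does), (1.56)∕(1.58) p. 86; `[Balaban1984PropagatorsII]` ("B6")
(2.3) p. 224 («Λ₀ = Ω₁ᶜ»: the level-`0` class holds every bond outside `Ω₁`, crossing `∂Ω₀` included).

CITATION HEADER (lean-in-tree rule).  Cell `pub-ymgap` (YM-PLAN Track A, HUMAN RULING D-0062), DAG node N06 = [B9], seat `pub-ymgap-dag-n06-b`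
generation 19 (the OWNER of the letter `QQZdP`, its binder editions and the class law `LevelSepPP`: p595278 ∕ p596576 ∕ p598097).

WHY THIS FILE (LOCATED-SELF-5, cell bus 2026-08-28T05:34Z).  The class law `LevelSepPP L m Ω ΛbP s` of p596576 and the box clause of `QQZdP_add ∕
QQZdP_smul_real` (p598097) ask, for EVERY level `j ≤ m`, that the box `[loK L j c₋, bondHiK L j c₋ κ]` of a class bond lie in `Ω_{j−1}`.  At `j = 0` that
box is the two-point set `{c₋, c₊}` (`loK L 0 z = z`, `bondHiK L 0 z κ = z + e_κ`) and `Ω_{0−1} = Ω₀`: the clause says «both ends of every level-`0` class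
bond lie in `Ω₀`».  PRINT'S level-`0` class at the cube member — dag-n05-c's `cubeLamBP … m 0`: every bond with an end in `□₀` (and none in `□₁`), the
bonds CROSSING `∂□₀` included (`mem_cubeLamBP_zero_of_crossB`) — violates it; only the split class `cubeLamBP'` (level `0` = inner bonds) obeys the law
(`B8CubeMemberLevelSep.levelSepPP_cubeLamBP'`), and generation 18 of this seat certified that class UNINHABITABLE at the junction's `InvAt(H)`
(`B9SupplySockB9P3ZdSkewGaugeModeCube.cube_invAtH_opsAllZd_false_cubeLamBP'`: the boundary pure gauge is a zero mode when the level-`0` crossing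
bonds are missing).  So, as typed, every curved-`U₀` road through the letter's law was closed to print's class: `avgAtP_withQQP ∕ avgAtγ_withQQP`
(`hlaw`), `QQZdP_add ∕ _smul_real`, and BY NAME dag-n06-w4's `qqLinearAt_withQQP ∕ invAt_opsAllZd_of_posDef ∕ five_binders_opsAllZd ∕
sockB9P3D4γI_at_opsAllZd`.  The clause is SPURIOUS at level `0`: `linCovIter L U₀ B 0 = B` — `Q₀` is the identity, it has no averaging box and needs
no regularity of the background.  THIS FILE is EDITION P₀: the same theorems with the box clause restricted to `1 ≤ j` (the proofs are the landed
ones with the `j = 0` branch read through `linCovIter_zero`), and print's class `cubeLamBP` shown to satisfy the restricted law at every truncation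
`m ≤ k` with collar `s = 1`.  Nothing landed is modified; every cited lemma is used BY NAME.

WHAT IS PROVED (kernel, 0 sorry; one displayed law `LevelSepPP0` with a body, theorems otherwise).
* §1 `norm_linCovIter_bump_le_of_reg17₀` ∕ `norm_linCovIter_le_of_reg17₀` — the companion's column bound ([5] (147) localised) and row-sum bound with
  the box hypothesis asked for `1 ≤ j` only (level `0`: the bump ∕ the field itself) · `clsField_add_of_reg17₀` ∕ `clsField_smul_of_reg17₀`.
* §2 ★ `LevelSepPP0 L m Ω ΛbP s` (def: `(1 ≤ j → y ∈ Ω (j − 1)) ∧` the collar clause of `LevelSepPP`) · `levelSepPP0_of_levelSepPP` · `hbox0_of_levelSepPP0`.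
* §3 ★ `QQZdP_add₀` ∕ ★ `QQZdP_smul_real₀` (unitary `U₀`, `2 ≤ L`, the box clause for `1 ≤ j ≤ m`; ALL fields) · `qqLinearAt_withQQP₀`.
* §4 ★★ `avgAtP_withQQP₀` — `AvgAtP L (withQQP τ L ΛbP ops₀) (qQ d L C_τ β_τ s) ΛbP M i m` under `LevelSepPP0 L m i.Ω ΛbP s` (`d ≥ 2`, `L ≥ 2`), SAME
  constant as edition P · `avgAtP_withQQP_complex₀` (A6 at `𝔸 = ℂ`) · ★★ `avgAtγ_withQQP₀` (the cube road's currency).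
* §5 at dag-n06-w4's four-letter record `opsAllZd`: `qqLinearInClassAt_withQQP₀` · ★ `linearOnDomAt_opsAllZd_of_unitary₀` (finite `Ω₀`, EVERY
  unitary `U₀`) · `avgAtγ_opsAllZd₀` · `invAt_opsAllZd_of_posDef₀` · `regularInClassAt_opsAllZd_of_posDef₀` · ★★ `sockB9P3D4γI_at_opsAllZd₀` (the
  finite-`Ω₀` supplier with `hlaw : LevelSepPP0 …`; everything else as in `B9SupplySockB9P3ZdAllLettersZd.sockB9P3D4γI_at_opsAllZd`).
* §6 PRINT'S CLASS OBEYS P₀: `endpoints_of_inBox_zero` (the level-`0` box is `{c₋, c₊}`) · `not_mem_cube_succ_of_mem_box_cubeLamBP` ·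
  `le_succ_of_bondTouches_box_cubeLamBP` (collar `s = 1`, every `j ≤ m`, level `0` included) · `hbox0_cubeLamBP` · ★★★ `levelSepPP0_cubeLamBP :
  LevelSepPP0 L m (cubeFam false L a M ρ k) (cubeLamBP L a M ρ k) 1` (`m ≤ k`, `1 ≤ L ≤ ρ`) · `levelSepPP0_cubeLamBP_of_eq` · ★★ `avgAtγ_withQQP_cubeLamBP`,
  `avgAtγ_opsAllZd_cubeLamBP`, `linearOnDomAt_opsAllZd_cubeLamBP` (the binder and the linearity AT PRINT'S CLASS, by name) · the scope certificate
  `not_levelSepPP_cubeLamBP_zero` (edition P's law FAILS at `cubeLamBP` whenever a crossing bond exists).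

HONEST SCOPE.  Bookkeeping of this seat's own letter at level `0` — no new estimate ([5] (147) enters only at `j ≥ 1`, as before); the law
`LevelSepPP0` is DISPLAYED and discharged here for the cube member only (`towerBondsP`: the law owners', one `1 ≤ j →` weaker than their landed
`LevelSepPP` instance); count-neutral helper of K1⁷ (`--supports stmt-QuantumFields-20542`); N05∕N06 NOT discharged; Theorem 3.11 ∕ 3.3 at curved
`U₀` NOT proved; one finite `𝕋⁴` programme at fixed `ε`, Bałaban as printed; R4 closes only the conditional finite-`𝕋⁴` rung `BalabanLadder.UV` —
nothing continuum ∕ `ℝ⁴` ∕ OS ∕ mass gap ∕ Clay.  Unit `pub-ymgap-dag-n06-b` (g19), 2026-08-28.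
-/

noncomputable section

open scoped BigOperators
open NormedSpace

namespace Literature.MathematicalPhysics.QuantumFieldTheory.Balaban1983to89.B9Eq316AveragingTransposeZdLevelZero

open B9Eq316AveragingTransposeZd B9Eq316AveragingTransposeZdPrinted B9Eq316AveragingTransposeZdLinear

-- `Site` alone could resolve to the torus sites of `Setup.lean`; re-export the `ℤ^d` sites of `B7Prop1Explicit`.
export B7Prop1Explicit (Site)

variable {d : ℕ} {𝔸 : Type*} [CStarAlgebra 𝔸]

/-! ## §1 The column ∕ row bounds and the class-field linearity with the box clause at the levels `j ≥ 1` only -/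

section Regime

open B7Prop1Explicit (U1 e)
open B7Prop1Local (InBox loK bondHiK)
open B7Prop2Explicit (unitaryUnits)
open B7Prop5Flat (BondIn bump)
open B7Prop4GeneralLevels (linCovIter linCovIter_zero)
open B7Prop5GeneralLevels (thetaGen)
open B8Eq146AExpansion (iEta)

variable [Nontrivial 𝔸]

omit [Nontrivial 𝔸] in
/-- `θ(α) ≥ 0` for `α ≥ 0`. [folklore] -/
private theorem thetaGen_nonneg {α : ℝ} (hα : 0 ≤ α) (L : ℕ) : 0 ≤ thetaGen d L α := by
  unfold thetaGen; positivity

omit [Nontrivial 𝔸] in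
/-- the single-bond variation is bounded by its value everywhere. [folklore] -/
private theorem norm_bump_le (y : Site d) (μ : Fin d) (X : 𝔸) (x : Site d) (κ : Fin d) : ‖bump y μ X x κ‖ ≤ ‖X‖ := by
  unfold bump
  split_ifs
  · exact le_rfl
  · rw [norm_zero]; exact norm_nonneg _

/-- ★ **THE COLUMN BOUND OF [5] (147), BOX CLAUSE AT `j ≥ 1` ONLY**: `‖LʲQ_j(U₀)(X·δ_b)(c)‖ ≤ (1 + θ(α))·Lʲ·L^{−jd}·‖X‖` for a unitary `U₀` in the class
(1.7) (`α ≤ α_Q`), `j ≤ m`, at a level-`j` bond `c` whose box lies in `Ω_j` WHEN `j ≥ 1` — at `j = 0` the composite is the identity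
(`linCovIter_zero`) and the bound is `‖(X·δ_b)(c)‖ ≤ ‖X‖`. [cite: Balaban1985Averaging, (147) p.40, (127) p.37; Balaban1985RegularSpaces, (1.7) p.77] -/
theorem norm_linCovIter_bump_le_of_reg17₀ {L : ℕ} (hL : 2 ≤ L) {m : ℕ} {Ω : ℕ → Set (Site d)} {α : ℝ} (hα : 0 < α)
    (hαQ : α ≤ alphaQ d L) {U₀ : Site d → Fin d → 𝔸ˣ} (hU₀ : ∀ x κ, U₀ x κ ∈ unitaryUnits 𝔸) (hreg : Reg17 L m Ω α U₀)
    {j : ℕ} (hj : j ≤ m) (z : Site d) (κ : Fin d) (hbox : 1 ≤ j → ∀ x, InBox (loK L j z) (bondHiK L j z κ) x → x ∈ Ω j)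
    (y : Site d) (μ : Fin d) (X : 𝔸) :
    ‖linCovIter L U₀ (bump y μ X) j z κ‖ ≤ (1 + thetaGen d L α) * ((L : ℝ) ^ j * (((L : ℝ) ^ j) ^ d)⁻¹) * ‖X‖ := by
  rcases Nat.eq_zero_or_pos j with rfl | hj1
  · rw [linCovIter_zero]
    have hθ := thetaGen_nonneg (d := d) hα.le L
    calc ‖bump y μ X z κ‖ ≤ ‖X‖ := norm_bump_le y μ X z κ
      _ = 1 * ((L : ℝ) ^ 0 * (((L : ℝ) ^ 0) ^ d)⁻¹) * ‖X‖ := by simp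
      _ ≤ (1 + thetaGen d L α) * ((L : ℝ) ^ 0 * (((L : ℝ) ^ 0) ^ d)⁻¹) * ‖X‖ := by
          refine mul_le_mul_of_nonneg_right (mul_le_mul_of_nonneg_right (by linarith) (by positivity)) (norm_nonneg _)
  · exact norm_linCovIter_bump_le_of_reg17 hL hα hαQ hU₀ hreg hj z κ (hbox hj1) y μ X

/-- ★ **THE ROW-SUM BOUND, BOX CLAUSE AT `j ≥ 1` ONLY**: for a bond field `B` bounded by `β` everywhere, `‖LʲQ_j(U₀)B(c)‖ ≤ 2d·(1 + θ(α))·Lʲ·β` at a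
level-`j` bond `c` as above (`d ≥ 1`; at `j = 0`: `‖B(c)‖ ≤ β`). [cite: Balaban1985Averaging, (147) p.40, (127) p.37; Balaban1985RegularSpaces, (1.7) p.77, (1.56) p.86] -/
theorem norm_linCovIter_le_of_reg17₀ (hd : 1 ≤ d) {L : ℕ} (hL : 2 ≤ L) {m : ℕ} {Ω : ℕ → Set (Site d)} {α : ℝ} (hα : 0 < α)
    (hαQ : α ≤ alphaQ d L) {U₀ : Site d → Fin d → 𝔸ˣ} (hU₀ : ∀ x κ, U₀ x κ ∈ unitaryUnits 𝔸) (hreg : Reg17 L m Ω α U₀)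
    {j : ℕ} (hj : j ≤ m) (z : Site d) (κ : Fin d) (hbox : 1 ≤ j → ∀ x, InBox (loK L j z) (bondHiK L j z κ) x → x ∈ Ω j)
    (B : Site d → Fin d → 𝔸) {β : ℝ} (hβ : 0 ≤ β) (hB : ∀ y μ, ‖B y μ‖ ≤ β) :
    ‖linCovIter L U₀ B j z κ‖ ≤ 2 * d * ((1 + thetaGen d L α) * (L : ℝ) ^ j) * β := by
  rcases Nat.eq_zero_or_pos j with rfl | hj1
  · rw [linCovIter_zero]
    have hθ := thetaGen_nonneg (d := d) hα.le L
    have hd' : (1 : ℝ) ≤ d := by exact_mod_cast hd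
    have h1 : (1 : ℝ) ≤ 2 * d * ((1 + thetaGen d L α) * (L : ℝ) ^ 0) := by
      rw [pow_zero, mul_one]; nlinarith
    calc ‖B z κ‖ ≤ β := hB z κ
      _ = 1 * β := (one_mul β).symm
      _ ≤ 2 * d * ((1 + thetaGen d L α) * (L : ℝ) ^ 0) * β := mul_le_mul_of_nonneg_right h1 hβ
  · exact norm_linCovIter_le_of_reg17 hL hα hαQ hU₀ hreg hj z κ (hbox hj1) B hβ fun y μ _ => hB y μ

omit [Nontrivial 𝔸] in
/-- `iη(A + A′) = iηA + iηA′` (private copy). [cite: Balaban1985RegularSpaces, (1.41) p.83 (the exponent variable `iηA`)] -/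
private theorem iEta_add (η : ℝ) (A A' : Site d → Fin d → 𝔸) : iEta η (A + A') = iEta η A + iEta η A' := by
  funext y κ; simp [iEta, smul_add]

omit [Nontrivial 𝔸] in
/-- `iη(r•A) = (r : ℂ)•iηA` for real `r` (private copy). [cite: Balaban1985RegularSpaces, (1.41) p.83 (the exponent variable `iηA`)] -/
private theorem iEta_smul (η : ℝ) (r : ℝ) (A : Site d → Fin d → 𝔸) : iEta η (r • A) = (r : ℂ) • iEta η A := by
  funext y κ
  simp only [iEta, Pi.smul_apply]
  rw [← Complex.coe_smul, smul_comm]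

/-- ★ **`𝟙_{Λ_j}·(−i)·LʲQ_j(U₀)(iη·)` IS ADDITIVE IN `A`, BOX CLAUSE AT `j ≥ 1` ONLY** (level `0`: `𝟙_{Λ₀}·(−i)·(iηA)`, additive outright).
[cite: Balaban1985BackgroundPropagators, (3.16) p.393; Balaban1985Averaging, (122) p.36, (127) p.37] -/
theorem clsField_add_of_reg17₀ {L : ℕ} (hL : 2 ≤ L) {m : ℕ} {Ω : ℕ → Set (Site d)} {α : ℝ} (hα : 0 < α)
    (hαQ : α ≤ alphaQ d L) {U₀ : Site d → Fin d → 𝔸ˣ} (hU₀ : ∀ x κ, U₀ x κ ∈ unitaryUnits 𝔸) (hreg : Reg17 L m Ω α U₀)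
    (ΛbP : ℕ → ℕ → Set (Site d × Fin d)) {j : ℕ} (hj : j ≤ m)
    (hbox : 1 ≤ j → ∀ c ∈ ΛbP m j, ∀ x, InBox (loK L j c.1) (bondHiK L j c.1 c.2) x → x ∈ Ω j)
    (η : ℝ) (A A' : Site d → Fin d → 𝔸) :
    clsField L ΛbP η m j U₀ (A + A') = clsField L ΛbP η m j U₀ A + clsField L ΛbP η m j U₀ A' := by
  rcases Nat.eq_zero_or_pos j with rfl | hj1
  · classical
    funext z κ
    simp only [clsField, Pi.add_apply]
    split_ifs with hc
    · rw [linCovIter_zero, linCovIter_zero, linCovIter_zero, iEta_add, Pi.add_apply, Pi.add_apply, smul_add]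
    · rw [add_zero]
  · exact clsField_add_of_reg17 hL hα hαQ hU₀ hreg ΛbP hj (hbox hj1) η A A'

/-- ★ **`𝟙_{Λ_j}·(−i)·LʲQ_j(U₀)(iη·)` IS REAL-HOMOGENEOUS IN `A`, BOX CLAUSE AT `j ≥ 1` ONLY.** [cite: Balaban1985BackgroundPropagators, (3.16) p.393; Balaban1985Averaging, (122) p.36, (127) p.37] -/
theorem clsField_smul_of_reg17₀ {L : ℕ} (hL : 2 ≤ L) {m : ℕ} {Ω : ℕ → Set (Site d)} {α : ℝ} (hα : 0 < α)
    (hαQ : α ≤ alphaQ d L) {U₀ : Site d → Fin d → 𝔸ˣ} (hU₀ : ∀ x κ, U₀ x κ ∈ unitaryUnits 𝔸) (hreg : Reg17 L m Ω α U₀)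
    (ΛbP : ℕ → ℕ → Set (Site d × Fin d)) {j : ℕ} (hj : j ≤ m)
    (hbox : 1 ≤ j → ∀ c ∈ ΛbP m j, ∀ x, InBox (loK L j c.1) (bondHiK L j c.1 c.2) x → x ∈ Ω j)
    (η : ℝ) (r : ℝ) (A : Site d → Fin d → 𝔸) :
    clsField L ΛbP η m j U₀ (r • A) = r • clsField L ΛbP η m j U₀ A := by
  rcases Nat.eq_zero_or_pos j with rfl | hj1
  · classical
    funext z κ
    simp only [clsField, Pi.smul_apply]
    split_ifs with hc
    · rw [linCovIter_zero, linCovIter_zero, iEta_smul, Pi.smul_apply, Pi.smul_apply, smul_comm, Complex.coe_smul]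
    · rw [smul_zero]
  · exact clsField_smul_of_reg17 hL hα hαQ hU₀ hreg ΛbP hj (hbox hj1) η r A

end Regime

/-! ## §2 The class law, EDITION P₀: the box clause at the levels `j ≥ 1` only -/

section Law

open B7Prop1Local (InBox loK bondHiK)
open B8Ineq132 (BondTouches)

/-- ★ **THE CLASS LAW, EDITION P₀** (print's (1.31)∕[B6] (2.2)–(2.3) with the level `0` read as printed): every site `y` of the box of a
level-`j` class bond lies in `Ω_{j−1}` WHEN `j ≥ 1` (the averaging boxes exist from level `1` on; `Q₀ = 1`), and — as in edition P — a unit bond at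
`y` touches `Ω_{i'}` only for `i' ≤ j + s` (the collars).  DISPLAYED; discharged for the cube member in §6.
[cite: Balaban1985RegularSpaces, (1.5) p.77, (1.28)–(1.31) pp.81–82; Balaban1984PropagatorsII, (2.1)–(2.3) p.224; Balaban1985Averaging, (127) p.37] -/
def LevelSepPP0 (L m : ℕ) (Ω : ℕ → Set (Site d)) (ΛbP : ℕ → ℕ → Set (Site d × Fin d)) (s : ℕ) : Prop :=
  ∀ j, j ≤ m → ∀ c ∈ ΛbP m j, ∀ y, InBox (loK L j c.1) (bondHiK L j c.1 c.2) y →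
    (1 ≤ j → y ∈ Ω (j - 1)) ∧ ∀ i', i' ≤ m → ∀ μ : Fin d, BondTouches (Ω i') y μ → i' ≤ j + s

/-- Edition P's law implies edition P₀'s (the box clause is only weakened). [cite: Balaban1985RegularSpaces, (1.31) p.82] -/
theorem levelSepPP0_of_levelSepPP {L m : ℕ} {Ω : ℕ → Set (Site d)} {ΛbP : ℕ → ℕ → Set (Site d × Fin d)} {s : ℕ}
    (h : LevelSepPP L m Ω ΛbP s) : LevelSepPP0 L m Ω ΛbP s :=
  fun j hj c hc y hy => ⟨fun _ => (h j hj c hc y hy).1, (h j hj c hc y hy).2⟩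

/-- The box clause (levels `j ≥ 1`) of edition P₀'s law, in the shape §3–§5 consume. [cite: Balaban1985RegularSpaces, (1.31) p.82] -/
theorem hbox0_of_levelSepPP0 {L m : ℕ} {Ω : ℕ → Set (Site d)} {ΛbP : ℕ → ℕ → Set (Site d × Fin d)} {s : ℕ}
    (hlaw : LevelSepPP0 L m Ω ΛbP s) :
    ∀ j, 1 ≤ j → j ≤ m → ∀ c ∈ ΛbP m j, ∀ x, InBox (loK L j c.1) (bondHiK L j c.1 c.2) x → x ∈ Ω (j - 1) :=
  fun j hj1 hj c hc x hx => (hlaw j hj c hc x hx).1 hj1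

end Law

/-! ## §3 The letter `QQZdP` is ℝ-linear in the field under the level-`≥ 1` box clause -/

section Letter

open B7Prop1Local (InBox loK bondHiK)
open B7Prop2Explicit (unitaryUnits)
open B8LeafModelZd (ZdIdx)
open B9SupplySockB9P3ZdLetters (OpsZd)
open B9SupplySockB9P3ZdGenuineGop (QQLinearAt)

variable (τ : 𝔸 →ₗ[ℂ] ℂ) [FiniteDimensional ℝ 𝔸] (L : ℕ) [Nontrivial 𝔸]

/-- ★ **EDITION P's LETTER IS ADDITIVE IN THE FIELD under the box clause AT THE LEVELS `j ≥ 1` ONLY**: for `L ≥ 2`, unitary `U₀`, a class whose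
level-`j` bonds (`1 ≤ j ≤ m`) have their box in `Ω_{j−1}`, and ALL fields `A, A′`: `QQZdP τ L ΛbP i m U₀ (A + A′) = QQZdP … A + QQZdP … A′` — print's
class `cubeLamBP` (crossing bonds at level `0`) INCLUDED (§6). [cite: Balaban1985BackgroundPropagators, (3.16) p.393 («we define an operator Q*aQ»); Balaban1985Averaging, (122) p.36, (127) p.37; Balaban1985RegularSpaces, (1.7) p.77, (1.31) p.82] -/
theorem QQZdP_add₀ (hL : 2 ≤ L) {ΛbP : ℕ → ℕ → Set (Site d × Fin d)} {i : ZdIdx d L} {m : ℕ}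
    (hbox : ∀ j, 1 ≤ j → j ≤ m → ∀ c ∈ ΛbP m j, ∀ x, InBox (loK L j c.1) (bondHiK L j c.1 c.2) x → x ∈ i.Ω (j - 1))
    {U₀ : Site d → Fin d → 𝔸ˣ} (hU₀ : ∀ x κ, U₀ x κ ∈ unitaryUnits 𝔸) (A A' : Site d → Fin d → 𝔸) :
    QQZdP τ L ΛbP i m U₀ (A + A') = QQZdP τ L ΛbP i m U₀ A + QQZdP τ L ΛbP i m U₀ A' := by
  have hL1 : 1 ≤ L := le_trans (by norm_num) hL
  have hL0 : (0 : ℝ) < L := by exact_mod_cast (lt_of_lt_of_le (by norm_num) hL)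
  funext y μ
  simp only [Pi.add_apply]
  by_cases hreg : Reg17 L m i.Ω (alphaQ d L / (L : ℝ) ^ 2) U₀
  · have hreg' : Reg17 L m (fun j => i.Ω (j - 1)) (alphaQ d L) U₀ := by
      have h := reg17_shift hL1 hreg
      rwa [div_mul_cancel₀ _ (by positivity)] at h
    rw [QQZdP_of_reg17 τ L hreg, QQZdP_of_reg17 τ L hreg, QQZdP_of_reg17 τ L hreg, ← Finset.sum_add_distrib]
    refine Finset.sum_congr rfl fun j hjm => ?_
    have hj : j ≤ m := by rw [Finset.mem_range] at hjm; omega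
    rw [clsField_add_of_reg17₀ hL (alphaQ_pos d hL1) le_rfl hU₀ hreg' ΛbP hj (fun hj1 => hbox j hj1 hj), linCovIterT_add, smul_add]
  · rw [QQZdP_of_not_reg17 τ L hreg, QQZdP_of_not_reg17 τ L hreg, QQZdP_of_not_reg17 τ L hreg, add_zero]

/-- ★ **EDITION P's LETTER IS REAL-HOMOGENEOUS IN THE FIELD under the box clause AT THE LEVELS `j ≥ 1` ONLY**: `QQZdP … (r • A) = r • QQZdP … A`.
[cite: Balaban1985BackgroundPropagators, (3.16) p.393; Balaban1985Averaging, (122) p.36, (127) p.37; Balaban1985RegularSpaces, (1.7) p.77, (1.31) p.82] -/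
theorem QQZdP_smul_real₀ (hL : 2 ≤ L) {ΛbP : ℕ → ℕ → Set (Site d × Fin d)} {i : ZdIdx d L} {m : ℕ}
    (hbox : ∀ j, 1 ≤ j → j ≤ m → ∀ c ∈ ΛbP m j, ∀ x, InBox (loK L j c.1) (bondHiK L j c.1 c.2) x → x ∈ i.Ω (j - 1))
    {U₀ : Site d → Fin d → 𝔸ˣ} (hU₀ : ∀ x κ, U₀ x κ ∈ unitaryUnits 𝔸) (r : ℝ) (A : Site d → Fin d → 𝔸) :
    QQZdP τ L ΛbP i m U₀ (r • A) = r • QQZdP τ L ΛbP i m U₀ A := by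
  have hL1 : 1 ≤ L := le_trans (by norm_num) hL
  have hL0 : (0 : ℝ) < L := by exact_mod_cast (lt_of_lt_of_le (by norm_num) hL)
  funext y μ
  simp only [Pi.smul_apply]
  by_cases hreg : Reg17 L m i.Ω (alphaQ d L / (L : ℝ) ^ 2) U₀
  · have hreg' : Reg17 L m (fun j => i.Ω (j - 1)) (alphaQ d L) U₀ := by
      have h := reg17_shift hL1 hreg
      rwa [div_mul_cancel₀ _ (by positivity)] at h
    rw [QQZdP_of_reg17 τ L hreg, QQZdP_of_reg17 τ L hreg, Finset.smul_sum]
    refine Finset.sum_congr rfl fun j hjm => ?_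
    have hj : j ≤ m := by rw [Finset.mem_range] at hjm; omega
    rw [clsField_smul_of_reg17₀ hL (alphaQ_pos d hL1) le_rfl hU₀ hreg' ΛbP hj (fun hj1 => hbox j hj1 hj), linCovIterT_smul, smul_comm]
  · rw [QQZdP_of_not_reg17 τ L hreg, QQZdP_of_not_reg17 τ L hreg, smul_zero]

/-- ★ **`QQLinearAt` FOR EDITION P under the level-`≥ 1` box clause** at every unitary `U₀` (`2 ≤ L`): the letter `QQZdP τ L ΛbP i m U₀` is the restriction
of an ℝ-linear map. [cite: Balaban1985BackgroundPropagators, (3.16) p.393 («an operator Q*aQ»)] -/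
theorem qqLinearAt_withQQP₀ (hL : 2 ≤ L) (ΛbP : ℕ → ℕ → Set (Site d × Fin d)) (ops₀ : ℝ → ZdIdx d L → ℕ → OpsZd d 𝔸) (M : ℝ)
    (i : ZdIdx d L) (m : ℕ)
    (hbox : ∀ j, 1 ≤ j → j ≤ m → ∀ c ∈ ΛbP m j, ∀ x, InBox (loK L j c.1) (bondHiK L j c.1 c.2) x → x ∈ i.Ω (j - 1))
    {U₀ : Site d → Fin d → 𝔸ˣ} (hU₀ : ∀ x κ, U₀ x κ ∈ unitaryUnits 𝔸) :
    QQLinearAt (withQQP τ L ΛbP ops₀ M i m) U₀ :=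
  ⟨{ toFun := QQZdP τ L ΛbP i m U₀, map_add' := QQZdP_add₀ τ L hL hbox hU₀, map_smul' := QQZdP_smul_real₀ τ L hL hbox hU₀ },
    fun _ => rfl⟩

end Letter

/-! ## §4 The averaging binder, EDITION P₀: `AvgAtP` ∕ `AvgAtγ` for the genuine letter under `LevelSepPP0` -/

section Binder

open B7Prop1Explicit (e)
open B7Prop1Local (InBox loK bondHiK)
open B7Prop2Explicit (unitaryUnits)
open B7Prop5Flat (BondIn bump)
open B7Prop4GeneralLevels (linCovIter linCovIter_zero)
open B7Prop5GeneralLevels (thetaGen)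
open B8Ineq132 (InAk BondTouches PlaqTouches plaqF)
open B8Eq140Level (SideTouches sideTouches_of_bondTouches)
open B8Eq146AExpansion (iEta norm_iEta_le)
open B8Eq155JBound (wsup wsup_le le_wsup wsup_nonneg)
open B8ScaledSupNorm (msup Bdd msup_nonneg norm_le_of_msup_le)
open B8LeafModelZd (ZdIdx)
open B9SupplySockB9P3ZdLetters (OpsZd)
open B9SupplySockB9P3ZdLettersOmega (OnDom)
open B9SupplySockB9P3ZdBeta (CrossB)
open B9SupplySockB9P3ZdGamma (AvgAtγ)
open B9SupplySockB9P3ZdGammaUniv (AvgAtP)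

variable (τ : 𝔸 →ₗ[ℂ] ℂ) [FiniteDimensional ℝ 𝔸] (L : ℕ)

omit [FiniteDimensional ℝ 𝔸] in
/-- `w_j ≥ 0` (private copy). [folklore] -/
private theorem wQ_nonneg {η : ℝ} (hη : 0 ≤ η) (j : ℕ) : 0 ≤ wQ (d := d) L η j := by
  unfold wQ; positivity

/-- `β_τ ≥ 0` (private copy). [folklore] -/
private theorem betaTau_nonneg : 0 ≤ betaTau τ := by
  unfold betaTau
  split_ifs
  · exact Finset.sum_nonneg fun i _ => mul_nonneg (norm_nonneg _) (norm_nonneg _)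
  · exact le_rfl

omit [CStarAlgebra 𝔸] [FiniteDimensional ℝ 𝔸] in
/-- in dimension `d ≥ 2` every direction has another one (private copy). [folklore] -/
private theorem exists_ne_dir (hd : 2 ≤ d) (μ : Fin d) : ∃ κ : Fin d, κ ≠ μ := by
  by_cases h : (μ : ℕ) = 0
  · exact ⟨⟨1, by omega⟩, fun hk => by have := congrArg Fin.val hk; simp at this; omega⟩
  · exact ⟨⟨0, by omega⟩, fun hk => by have := congrArg Fin.val hk; simp at this; omega⟩

omit [CStarAlgebra 𝔸] [FiniteDimensional ℝ 𝔸] in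
/-- the finite geometric bound behind the `m`-uniformity of `q` (private copy of edition P's): `Σ_{j ≤ m, j₀ ≤ j+s} (L³)^s·(L⁻³)^{j+s−j₀} ≤ 2(L³)^s`
(`L ≥ 2`). [folklore] -/
private theorem level_sum_le {L : ℕ} (hL : 2 ≤ L) (m j₀ s : ℕ) :
    ∑ j ∈ Finset.range (m + 1),
        (if j₀ ≤ j + s then ((L : ℝ) ^ 3) ^ s * (((L : ℝ) ^ 3)⁻¹) ^ (j + s - j₀) else 0)
      ≤ 2 * ((L : ℝ) ^ 3) ^ s := by
  classical
  have hL' : (2 : ℝ) ≤ L := by exact_mod_cast hL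
  set r : ℝ := ((L : ℝ) ^ 3)⁻¹ with hr
  have hL3 : (8 : ℝ) ≤ (L : ℝ) ^ 3 := by
    have h := pow_le_pow_left₀ (by norm_num : (0 : ℝ) ≤ 2) hL' 3
    norm_num at h
    exact h
  have hr0 : 0 ≤ r := by rw [hr]; positivity
  have hr1 : r ≤ 1 / 2 := by
    rw [hr, inv_le_comm₀ (by positivity) (by norm_num)]
    linarith
  have hP : 0 ≤ ((L : ℝ) ^ 3) ^ s := by positivity
  set S := (Finset.range (m + 1)).filter (fun j => j₀ ≤ j + s) with hS
  have hsum : ∑ j ∈ Finset.range (m + 1),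
        (if j₀ ≤ j + s then ((L : ℝ) ^ 3) ^ s * r ^ (j + s - j₀) else 0)
      = ((L : ℝ) ^ 3) ^ s * ∑ j ∈ S, r ^ (j + s - j₀) := by
    rw [hS, Finset.sum_filter, Finset.mul_sum]
    refine Finset.sum_congr rfl fun j _ => ?_
    split_ifs <;> simp
  rw [hsum, mul_comm (2 : ℝ)]
  refine mul_le_mul_of_nonneg_left ?_ hP
  have hinj : Set.InjOn (fun j => j + s - j₀) (S : Set ℕ) := by
    intro a ha b hb hab
    simp only [hS, Finset.coe_filter, Finset.mem_range, Set.mem_setOf_eq] at ha hb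
    simp only at hab
    omega
  calc ∑ j ∈ S, r ^ (j + s - j₀) = ∑ n ∈ S.image (fun j => j + s - j₀), r ^ n := (Finset.sum_image hinj).symm
    _ ≤ ∑ n ∈ Finset.range (m + 1 + s), r ^ n := by
        refine Finset.sum_le_sum_of_subset_of_nonneg (fun n hn => ?_) (fun n _ _ => by positivity)
        simp only [Finset.mem_image, hS, Finset.mem_filter, Finset.mem_range] at hn
        obtain ⟨j, ⟨hj, hj'⟩, rfl⟩ := hn
        simp only [Finset.mem_range]
        omega
    _ = ∑ n ∈ Finset.Ico 0 (m + 1 + s), r ^ n := by rw [Finset.range_eq_Ico]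
    _ ≤ r ^ 0 / (1 - r) := geom_sum_Ico_le_of_lt_one hr0 (by linarith)
    _ ≤ 2 := by
        rw [pow_zero, div_le_iff₀ (by linarith)]
        linarith

variable [Nontrivial 𝔸]

set_option maxHeartbeats 400000 in
/-- ★★ **EDITION P₀ — THE AVERAGING BINDER FOR THE GENUINE LETTER UNDER THE LEVEL-`≥ 1` BOX LAW** ([B8] (1.56)∕(1.58) for [B9] (3.16)): the theorem
`avgAtP_withQQP` VERBATIM with `hlaw : LevelSepPP0 L m i.Ω ΛbP s` (box of a level-`j` class bond `⊂ Ω_{j−1}` asked for `j ≥ 1` only; the collar clause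
unchanged) and the SAME constant `q = qQ d L C_τ β_τ s`: `(L^{j₀}η)³‖(Q*aQ A)(b)‖ ≤ q·|B₁|(A)` at every bond `b` touching `Ω_{j₀}`, every `A ∈ E(Ω₀)`, every
unitary `U₀` — the level `0` term `w₀·Q₀ᵀ(𝟙_{Λ₀}Q₀(iηA))` read with `Q₀ = 1`.  USE THIS EDITION at print's class `cubeLamBP` (§6).
[cite: Balaban1985BackgroundPropagators, (3.16) p.393, (3.26)–(3.27) p.395; Balaban1985RegularSpaces, (1.56), (1.58)–(1.59) p.86, (1.7) p.77, (1.31) p.82; Balaban1985Averaging, (147) p.40, (127) p.37, Prop. 5 p.42] -/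
theorem avgAtP_withQQP₀ (hd : 2 ≤ d) (hL : 2 ≤ L)
    {Cτ : ℝ} (hCτ : ∀ x y : 𝔸, |(τ (star x * y)).re| ≤ Cτ * ‖x‖ * ‖y‖)
    (ΛbP : ℕ → ℕ → Set (Site d × Fin d)) (ops₀ : ℝ → ZdIdx d L → ℕ → OpsZd d 𝔸) (M : ℝ) (i : ZdIdx d L)
    (m : ℕ) {s : ℕ} (hlaw : LevelSepPP0 L m i.Ω ΛbP s) :
    AvgAtP L (withQQP τ L ΛbP ops₀) (qQ d L Cτ (betaTau τ) s) ΛbP M i m := by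
  classical
  intro U₀ hU₀ A hOn j₀ hj₀ y μ htouch
  have hd1 : 1 ≤ d := le_trans (by norm_num) hd
  have hL1 : 1 ≤ L := le_trans (by norm_num) hL
  have hL0 : (0 : ℝ) < L := by exact_mod_cast (lt_of_lt_of_le (by norm_num) hL)
  have hη := i.hη
  have hCτ0 : 0 ≤ Cτ := by
    have h := hCτ 1 1
    simp only [norm_one, mul_one] at h
    exact (abs_nonneg _).trans h
  have hβτ := betaTau_nonneg τ
  have hθpos : 0 < 1 + thetaGen d L (alphaQ d L) := by
    have := alphaQ_pos d hL1; unfold thetaGen; positivity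
  have hθ0 : 0 ≤ 1 + thetaGen d L (alphaQ d L) := hθpos.le
  -- the right-hand side
  set W := wsup 1 (fun p : {p : ℕ × (Site d × Fin d) // p.1 ≤ m ∧ p.2 ∈ ΛbP m p.1} =>
      linCovIter L U₀ (iEta i.η A) p.1.1 p.1.2.1 p.1.2.2) with hW
  have hW0 : 0 ≤ W := wsup_nonneg zero_le_one _
  have hq0 : 0 ≤ qQ d L Cτ (betaTau τ) s := by unfold qQ; positivity
  show ((L : ℝ) ^ j₀ * i.η) ^ 3 * ‖QQZdP τ L ΛbP i m U₀ A y μ‖ ≤ qQ d L Cτ (betaTau τ) s * W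
  by_cases hreg : Reg17 L m i.Ω (alphaQ d L / (L : ℝ) ^ 2) U₀
  swap
  · rw [QQZdP_of_not_reg17 τ L hreg, norm_zero, mul_zero]; positivity
  rw [QQZdP_of_reg17 τ L hreg]
  -- the shifted reading of the class (1.7): window `α_Q` on the domains `Ω_{j−1}`
  have hreg' : Reg17 L m (fun j => i.Ω (j - 1)) (alphaQ d L) U₀ := by
    have h := reg17_shift hL1 hreg
    rwa [div_mul_cancel₀ _ (by positivity)] at h
  -- (1) `A ∈ E(Ω₀)` is bounded, hence so is `iηA`
  obtain ⟨β, hβ0, hAβ⟩ : ∃ β : ℝ, 0 ≤ β ∧ ∀ z ν, ‖iEta i.η A z ν‖ ≤ β := by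
    set c := msup L m i.η (-(1 : ℝ)) (fun j (b : Site d × Fin d) => SideTouches (i.Ω j) b.1 b.2) (fun b => A b.1 b.2)
      with hc
    have hc0 : 0 ≤ c := msup_nonneg L m hη.le _ _ _
    refine ⟨i.η * (c * (((L : ℝ) ^ 0 * i.η) ^ (-(1 : ℝ)))), by positivity, fun z ν => norm_iEta_le hη.le (fun z ν => ?_) z ν⟩
    by_cases hb : BondTouches (i.Ω 0) z ν
    · obtain ⟨κ, hκ⟩ := exists_ne_dir hd ν
      exact norm_le_of_msup_le (F := fun b : Site d × Fin d => A b.1 b.2) hL1 hη hOn.2 le_rfl (Nat.zero_le m)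
        (i := (z, ν)) (sideTouches_of_bondTouches hκ hb)
    · rw [hOn.1 z ν hb, norm_zero]; positivity
  -- (2) the averaged family over the class bonds is bounded (row sums), so each member is below `W`
  have hbox : ∀ j, j ≤ m → ∀ c ∈ ΛbP m j, 1 ≤ j → ∀ x, InBox (loK L j c.1) (bondHiK L j c.1 c.2) x →
      x ∈ (fun j' => i.Ω (j' - 1)) j :=
    fun j hj c hc hj1 x hx => (hlaw j hj c hc x hx).1 hj1
  have hB1 : ∀ j, j ≤ m → ∀ c ∈ ΛbP m j, ‖linCovIter L U₀ (iEta i.η A) j c.1 c.2‖ ≤ W := by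
    intro j hj c hc
    have hbd : ∀ p : {p : ℕ × (Site d × Fin d) // p.1 ≤ m ∧ p.2 ∈ ΛbP m p.1},
        1 * ‖linCovIter L U₀ (iEta i.η A) p.1.1 p.1.2.1 p.1.2.2‖ ≤
          2 * d * ((1 + thetaGen d L (alphaQ d L)) * (L : ℝ) ^ m) * β := by
      intro p
      rw [one_mul]
      refine (norm_linCovIter_le_of_reg17₀ hd1 hL (alphaQ_pos d hL1) le_rfl hU₀ hreg' p.2.1 p.1.2.1 p.1.2.2
        (hbox _ p.2.1 _ p.2.2) _ hβ0 (fun z ν => hAβ z ν)).trans ?_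
      have hpow : (L : ℝ) ^ p.1.1 ≤ (L : ℝ) ^ m := pow_le_pow_right₀ (by exact_mod_cast hL1) p.2.1
      have hd0 : (0 : ℝ) ≤ d := Nat.cast_nonneg d
      exact mul_le_mul_of_nonneg_right (mul_le_mul_of_nonneg_left (mul_le_mul_of_nonneg_left hpow hθ0) (by positivity)) hβ0
    have h := le_wsup hbd ⟨(j, c), hj, hc⟩
    rwa [one_mul] at h
  -- (3) the level-`j` term
  set C : ℝ := 2 * d * (Cτ * betaTau τ * (1 + thetaGen d L (alphaQ d L))) with hC
  have hC0 : 0 ≤ C := by positivity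
  have hlevel : ∀ j ∈ Finset.range (m + 1),
      ((L : ℝ) ^ j₀ * i.η) ^ 3 * ‖(wQ (d := d) L i.η j) • linCovIterT τ L U₀ j (clsField L ΛbP i.η m j U₀ A) y μ‖ ≤
        C * W * (if j₀ ≤ j + s then ((L : ℝ) ^ 3) ^ s * (((L : ℝ) ^ 3)⁻¹) ^ (j + s - j₀) else 0) := by
    intro j hjm
    rw [Finset.mem_range] at hjm
    have hj : j ≤ m := by omega
    -- the column bound at the window bonds carrying class values
    have hK0 : 0 ≤ (1 + thetaGen d L (alphaQ d L)) * ((L : ℝ) ^ j * (((L : ℝ) ^ j) ^ d)⁻¹) := by positivity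
    have hcol : ∀ (κ : Fin d) (t : Fin 2), clsField L ΛbP i.η m j U₀ A (winBase L j y κ t) κ ≠ 0 →
        ∀ X : 𝔸, ‖linCovIter L U₀ (bump y μ X) j (winBase L j y κ t) κ‖ ≤
          (1 + thetaGen d L (alphaQ d L)) * ((L : ℝ) ^ j * (((L : ℝ) ^ j) ^ d)⁻¹) * ‖X‖ := by
      intro κ t hne X
      have hmem : (winBase L j y κ t, κ) ∈ ΛbP m j := by
        by_contra hn; exact hne (by simp [clsField, hn])
      exact norm_linCovIter_bump_le_of_reg17₀ hL (alphaQ_pos d hL1) le_rfl hU₀ hreg' hj _ κ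
        (hbox j hj _ hmem) y μ X
    have hT := norm_linCovIterT_le τ hCτ L U₀ j (clsField L ΛbP i.η m j U₀ A) y μ hK0 hcol
    -- the class values are below `W`, and vanish off the class
    have hval : ∀ (κ : Fin d) (t : Fin 2), ‖clsField L ΛbP i.η m j U₀ A (winBase L j y κ t) κ‖ ≤
        if (winBase L j y κ t, κ) ∈ ΛbP m j then W else 0 := by
      intro κ t
      unfold clsField
      split_ifs with hmem
      · rw [norm_smul, norm_neg, Complex.norm_I, one_mul]
        exact hB1 j hj _ hmem
      · rw [norm_zero]
    by_cases hP : ∃ (κ : Fin d) (t : Fin 2), (winBase L j y κ t, κ) ∈ ΛbP m j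
    · -- some window bond is a class bond: the class law gives `j₀ ≤ j + s`
      obtain ⟨κ₀, t₀, hmem₀⟩ := hP
      have hsep : j₀ ≤ j + s := (hlaw j hj _ hmem₀ y (inBox_winBase hL1 j y κ₀ t₀)).2 j₀ hj₀ μ htouch
      rw [if_pos hsep]
      have hsumW : ∑ κ : Fin d, ∑ t : Fin 2, ‖clsField L ΛbP i.η m j U₀ A (winBase L j y κ t) κ‖ ≤ 2 * d * W := by
        calc ∑ κ : Fin d, ∑ t : Fin 2, ‖clsField L ΛbP i.η m j U₀ A (winBase L j y κ t) κ‖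
            ≤ ∑ κ : Fin d, ∑ t : Fin 2, W :=
              Finset.sum_le_sum fun κ _ => Finset.sum_le_sum fun t _ => (hval κ t).trans (by split_ifs <;> linarith)
          _ = 2 * d * W := by simp [Finset.sum_const, Finset.card_univ, Fintype.card_fin]; ring
      -- weights: `(L^{j₀}η)³ · w_j · K_j = L^{3(j₀ − j)} · (1+θ)` and `L^{3(j₀−j)} = (L³)^s (L⁻³)^{j+s−j₀}`
      have hLj : (0 : ℝ) < (L : ℝ) ^ j := by positivity
      have hwt : ((L : ℝ) ^ j₀ * i.η) ^ 3 * (wQ (d := d) L i.η j *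
          ((1 + thetaGen d L (alphaQ d L)) * ((L : ℝ) ^ j * (((L : ℝ) ^ j) ^ d)⁻¹))) =
            (1 + thetaGen d L (alphaQ d L)) * (((L : ℝ) ^ 3) ^ s * (((L : ℝ) ^ 3)⁻¹) ^ (j + s - j₀)) := by
        obtain ⟨n, hn⟩ : ∃ n, n = j + s - j₀ := ⟨_, rfl⟩
        have hn' : j₀ + n = s + j := by omega
        rw [← hn]
        have hkey : ((L : ℝ) ^ 3) ^ j₀ * ((L : ℝ) ^ 3) ^ n = ((L : ℝ) ^ 3) ^ s * ((L : ℝ) ^ 3) ^ j := by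
          rw [← pow_add, ← pow_add, hn']
        have hη0 : i.η ≠ 0 := hη.ne'
        have h1 : ((L : ℝ) ^ j₀ * i.η) ^ 3 * ((((L : ℝ) ^ j * i.η) ^ 3)⁻¹) = ((L : ℝ) ^ 3) ^ j₀ * (((L : ℝ) ^ 3) ^ j)⁻¹ := by
          field_simp
          ring
        have h2 : (((L : ℝ) ^ j) ^ d * ((L : ℝ) ^ j)⁻¹) * ((L : ℝ) ^ j * (((L : ℝ) ^ j) ^ d)⁻¹) = 1 := by
          field_simp
        calc ((L : ℝ) ^ j₀ * i.η) ^ 3 * (wQ (d := d) L i.η j *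
              ((1 + thetaGen d L (alphaQ d L)) * ((L : ℝ) ^ j * (((L : ℝ) ^ j) ^ d)⁻¹)))
            = (1 + thetaGen d L (alphaQ d L)) * (((L : ℝ) ^ j₀ * i.η) ^ 3 * ((((L : ℝ) ^ j * i.η) ^ 3)⁻¹)) *
                ((((L : ℝ) ^ j) ^ d * ((L : ℝ) ^ j)⁻¹) * ((L : ℝ) ^ j * (((L : ℝ) ^ j) ^ d)⁻¹)) := by
              unfold wQ; ring
          _ = (1 + thetaGen d L (alphaQ d L)) * (((L : ℝ) ^ 3) ^ j₀ * (((L : ℝ) ^ 3) ^ j)⁻¹) := by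
              rw [h1, h2, mul_one]
          _ = (1 + thetaGen d L (alphaQ d L)) * (((L : ℝ) ^ 3) ^ s * (((L : ℝ) ^ 3)⁻¹) ^ n) := by
              rw [inv_pow]
              congr 1
              rw [← div_eq_mul_inv, ← div_eq_mul_inv, div_eq_div_iff (by positivity) (by positivity), hkey]
      calc ((L : ℝ) ^ j₀ * i.η) ^ 3 * ‖(wQ (d := d) L i.η j) • linCovIterT τ L U₀ j (clsField L ΛbP i.η m j U₀ A) y μ‖
          = ((L : ℝ) ^ j₀ * i.η) ^ 3 * (wQ (d := d) L i.η j * ‖linCovIterT τ L U₀ j (clsField L ΛbP i.η m j U₀ A) y μ‖) := by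
            rw [norm_smul, Real.norm_of_nonneg (wQ_nonneg L hη.le j)]
        _ ≤ ((L : ℝ) ^ j₀ * i.η) ^ 3 * (wQ (d := d) L i.η j *
              (Cτ * betaTau τ * ((1 + thetaGen d L (alphaQ d L)) * ((L : ℝ) ^ j * (((L : ℝ) ^ j) ^ d)⁻¹)) * (2 * d * W))) := by
            refine mul_le_mul_of_nonneg_left (mul_le_mul_of_nonneg_left (hT.trans ?_) (wQ_nonneg L hη.le j)) (by positivity)
            exact mul_le_mul_of_nonneg_left hsumW (by positivity)
        _ = C * W * (((L : ℝ) ^ 3) ^ s * (((L : ℝ) ^ 3)⁻¹) ^ (j + s - j₀)) := by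
            rw [hC]
            linear_combination (Cτ * betaTau τ * (2 * d * W)) * hwt
    · -- no window bond is a class bond: the level-`j` term vanishes
      simp only [not_exists] at hP
      have hzero : ∑ κ : Fin d, ∑ t : Fin 2, ‖clsField L ΛbP i.η m j U₀ A (winBase L j y κ t) κ‖ = 0 := by
        refine Finset.sum_eq_zero fun κ _ => Finset.sum_eq_zero fun t _ => ?_
        have h := hval κ t
        rw [if_neg (hP κ t)] at h
        exact le_antisymm h (norm_nonneg _)
      rw [hzero, mul_zero] at hT
      have hT0 : linCovIterT τ L U₀ j (clsField L ΛbP i.η m j U₀ A) y μ = 0 := norm_le_zero_iff.1 hT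
      rw [hT0, smul_zero, norm_zero, mul_zero]
      split_ifs <;> positivity
  -- (4) sum the levels
  calc ((L : ℝ) ^ j₀ * i.η) ^ 3 *
        ‖∑ j ∈ Finset.range (m + 1), (wQ (d := d) L i.η j) • linCovIterT τ L U₀ j (clsField L ΛbP i.η m j U₀ A) y μ‖
      ≤ ((L : ℝ) ^ j₀ * i.η) ^ 3 *
          ∑ j ∈ Finset.range (m + 1), ‖(wQ (d := d) L i.η j) • linCovIterT τ L U₀ j (clsField L ΛbP i.η m j U₀ A) y μ‖ :=
        mul_le_mul_of_nonneg_left (norm_sum_le _ _) (by positivity)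
    _ = ∑ j ∈ Finset.range (m + 1),
          ((L : ℝ) ^ j₀ * i.η) ^ 3 * ‖(wQ (d := d) L i.η j) • linCovIterT τ L U₀ j (clsField L ΛbP i.η m j U₀ A) y μ‖ := by
        rw [Finset.mul_sum]
    _ ≤ ∑ j ∈ Finset.range (m + 1),
          C * W * (if j₀ ≤ j + s then ((L : ℝ) ^ 3) ^ s * (((L : ℝ) ^ 3)⁻¹) ^ (j + s - j₀) else 0) := Finset.sum_le_sum hlevel
    _ = C * W * ∑ j ∈ Finset.range (m + 1),
          (if j₀ ≤ j + s then ((L : ℝ) ^ 3) ^ s * (((L : ℝ) ^ 3)⁻¹) ^ (j + s - j₀) else 0) := by rw [Finset.mul_sum]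
    _ ≤ C * W * (2 * ((L : ℝ) ^ 3) ^ s) := mul_le_mul_of_nonneg_left (level_sum_le hL m j₀ s) (by positivity)
    _ = qQ d L Cτ (betaTau τ) s * W := by rw [hC, qQ]; ring

omit [Nontrivial 𝔸] in
/-- the identity functional on `ℂ` obeys `|Re (x̄·y)| ≤ ‖x‖‖y‖` (private copy). [folklore] -/
private theorem abs_re_star_mul_le_complex (x y : ℂ) :
    |((LinearMap.id : ℂ →ₗ[ℂ] ℂ) (star x * y)).re| ≤ 1 * ‖x‖ * ‖y‖ := by
  rw [LinearMap.id_apply, one_mul]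
  calc |(star x * y).re| ≤ ‖star x * y‖ := Complex.abs_re_le_norm _
    _ = ‖x‖ * ‖y‖ := by rw [norm_mul, norm_star]

/-- ★ **A6 — edition P₀'s binder at `𝔸 = ℂ`, `τ = id`** (`C_τ = 1`, the finite fibre hypotheses discharged). [cite: Balaban1985BackgroundPropagators, (3.16) p.393; Balaban1985RegularSpaces, (1.56), (1.58) p.86] -/
theorem avgAtP_withQQP_complex₀ (hd : 2 ≤ d) {L : ℕ} (hL : 2 ≤ L) (ΛbP : ℕ → ℕ → Set (Site d × Fin d))
    (ops₀ : ℝ → ZdIdx d L → ℕ → OpsZd d ℂ) (M : ℝ) (i : ZdIdx d L) (m : ℕ) {s : ℕ} (hlaw : LevelSepPP0 L m i.Ω ΛbP s) :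
    AvgAtP L (withQQP (LinearMap.id : ℂ →ₗ[ℂ] ℂ) L ΛbP ops₀) (qQ d L 1 (betaTau (LinearMap.id : ℂ →ₗ[ℂ] ℂ)) s) ΛbP M i m :=
  avgAtP_withQQP₀ (LinearMap.id : ℂ →ₗ[ℂ] ℂ) L hd hL abs_re_star_mul_le_complex ΛbP ops₀ M i m hlaw

/-- ★★ **EDITION P₀ IN THE γ CURRENCY** (`|B₁|` over the class together with the level-`0` crossing bonds of `Ω₀` — `B9SupplySockB9P3ZdGamma.AvgAtγ`):
`avgAtγ_withQQP` VERBATIM with `hlaw : LevelSepPP0 L m i.Ω ΛbP s`; same constant.  The cube road's binder for the genuine letter at print's class (§6).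
[cite: Balaban1985BackgroundPropagators, (3.16) p.393; Balaban1985RegularSpaces, (1.56), (1.58) p.86, p.77, (1.31) p.82; Balaban1985Averaging, (127) p.37] -/
theorem avgAtγ_withQQP₀ (hd : 2 ≤ d) (hL : 2 ≤ L)
    {Cτ : ℝ} (hCτ : ∀ x y : 𝔸, |(τ (star x * y)).re| ≤ Cτ * ‖x‖ * ‖y‖)
    (ΛbP : ℕ → ℕ → Set (Site d × Fin d)) (ops₀ : ℝ → ZdIdx d L → ℕ → OpsZd d 𝔸) (M : ℝ) (i : ZdIdx d L)
    (m : ℕ) {s : ℕ} (hlaw : LevelSepPP0 L m i.Ω ΛbP s) :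
    AvgAtγ L (withQQP τ L ΛbP ops₀) (qQ d L Cτ (betaTau τ) s) ΛbP M i m := by
  classical
  intro U₀ hU₀ A hOn j₀ hj₀ y μ htouch
  have hd1 : 1 ≤ d := le_trans (by norm_num) hd
  have hL1 : 1 ≤ L := le_trans (by norm_num) hL
  have hL0 : (0 : ℝ) < L := by exact_mod_cast (lt_of_lt_of_le (by norm_num) hL)
  have hη := i.hη
  have hCτ0 : 0 ≤ Cτ := by
    have h := hCτ 1 1
    simp only [norm_one, mul_one] at h
    exact (abs_nonneg _).trans h
  have hβτ := betaTau_nonneg τ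
  have hθpos : 0 < 1 + thetaGen d L (alphaQ d L) := by
    have := alphaQ_pos d hL1; unfold thetaGen; positivity
  have hq0 : 0 ≤ qQ d L Cτ (betaTau τ) s := by unfold qQ; positivity
  set Wγ := wsup 1 (fun p : {p : ℕ × (Site d × Fin d) // p.1 ≤ m ∧ (p.2 ∈ ΛbP m p.1 ∨ (p.1 = 0 ∧ CrossB (i.Ω 0) p.2))} =>
      linCovIter L U₀ (iEta i.η A) p.1.1 p.1.2.1 p.1.2.2) with hWγ
  have hWγ0 : 0 ≤ Wγ := wsup_nonneg zero_le_one _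
  show ((L : ℝ) ^ j₀ * i.η) ^ 3 * ‖QQZdP τ L ΛbP i m U₀ A y μ‖ ≤ qQ d L Cτ (betaTau τ) s * Wγ
  by_cases hreg : Reg17 L m i.Ω (alphaQ d L / (L : ℝ) ^ 2) U₀
  swap
  · rw [QQZdP_of_not_reg17 τ L hreg, norm_zero, mul_zero]; positivity
  -- on the class: the `AvgAtP` bound, then `|B₁|(class) ≤ |B₁|(class ∪ crossing)`
  have hP := avgAtP_withQQP₀ τ L hd hL hCτ ΛbP ops₀ M i m hlaw U₀ hU₀ A hOn j₀ hj₀ y μ htouch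
  rw [withQQP_QQ] at hP
  refine hP.trans (mul_le_mul_of_nonneg_left ?_ hq0)
  -- the larger family is bounded
  have hreg' : Reg17 L m (fun j => i.Ω (j - 1)) (alphaQ d L) U₀ := by
    have h := reg17_shift hL1 hreg
    rwa [div_mul_cancel₀ _ (by positivity)] at h
  obtain ⟨β, hβ0, hAβ⟩ : ∃ β : ℝ, 0 ≤ β ∧ ∀ z ν, ‖iEta i.η A z ν‖ ≤ β := by
    set c := msup L m i.η (-(1 : ℝ)) (fun j (b : Site d × Fin d) => SideTouches (i.Ω j) b.1 b.2) (fun b => A b.1 b.2)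
      with hc
    have hc0 : 0 ≤ c := msup_nonneg L m hη.le _ _ _
    refine ⟨i.η * (c * (((L : ℝ) ^ 0 * i.η) ^ (-(1 : ℝ)))), by positivity, fun z ν => norm_iEta_le hη.le (fun z ν => ?_) z ν⟩
    by_cases hb : BondTouches (i.Ω 0) z ν
    · obtain ⟨κ, hκ⟩ := exists_ne_dir hd ν
      exact norm_le_of_msup_le (F := fun b : Site d × Fin d => A b.1 b.2) hL1 hη hOn.2 le_rfl (Nat.zero_le m)
        (i := (z, ν)) (sideTouches_of_bondTouches hκ hb)
    · rw [hOn.1 z ν hb, norm_zero]; positivity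
  have hbox : ∀ j, j ≤ m → ∀ c ∈ ΛbP m j, 1 ≤ j → ∀ x, InBox (loK L j c.1) (bondHiK L j c.1 c.2) x →
      x ∈ (fun j' => i.Ω (j' - 1)) j :=
    fun j hj c hc hj1 x hx => (hlaw j hj c hc x hx).1 hj1
  set R : ℝ := β + 2 * d * ((1 + thetaGen d L (alphaQ d L)) * (L : ℝ) ^ m) * β with hR
  have hd0 : (0 : ℝ) ≤ d := Nat.cast_nonneg d
  have hR1 : β ≤ R := by
    have h := mul_nonneg (mul_nonneg (by positivity : (0 : ℝ) ≤ 2 * d)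
      (mul_nonneg hθpos.le (pow_nonneg hL0.le m))) hβ0
    rw [hR]; linarith
  have hbdγ : ∀ p : {p : ℕ × (Site d × Fin d) // p.1 ≤ m ∧ (p.2 ∈ ΛbP m p.1 ∨ (p.1 = 0 ∧ CrossB (i.Ω 0) p.2))},
      1 * ‖linCovIter L U₀ (iEta i.η A) p.1.1 p.1.2.1 p.1.2.2‖ ≤ R := by
    intro p
    rw [one_mul]
    rcases p.2.2 with hc | ⟨h0, -⟩
    · refine (norm_linCovIter_le_of_reg17₀ hd1 hL (alphaQ_pos d hL1) le_rfl hU₀ hreg' p.2.1 p.1.2.1 p.1.2.2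
        (hbox _ p.2.1 _ hc) _ hβ0 (fun z ν => hAβ z ν)).trans ?_
      have hpow : (L : ℝ) ^ p.1.1 ≤ (L : ℝ) ^ m := pow_le_pow_right₀ (by exact_mod_cast hL1) p.2.1
      calc 2 * d * ((1 + thetaGen d L (alphaQ d L)) * (L : ℝ) ^ p.1.1) * β
          ≤ 2 * d * ((1 + thetaGen d L (alphaQ d L)) * (L : ℝ) ^ m) * β :=
            mul_le_mul_of_nonneg_right (mul_le_mul_of_nonneg_left (mul_le_mul_of_nonneg_left hpow hθpos.le) (by positivity)) hβ0
        _ ≤ R := by rw [hR]; linarith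
    · have h00 : p.1.1 = 0 := h0
      rw [h00, linCovIter_zero]
      exact (hAβ _ _).trans hR1
  refine wsup_le (fun p => ?_) hWγ0
  exact le_wsup hbdγ ⟨p.1, p.2.1, Or.inl p.2.2⟩

end Binder

/-! ## §5 At dag-n06-w4's four-letter record `opsAllZd`: linearity at every unitary `U₀`, the binders and the finite-`Ω₀` supplier under P₀ -/

section Record

open B7Prop1Local (InBox loK bondHiK)
open B7Prop2Explicit (unitaryUnits)
open B8LeafModelZd (ZdIdx)
open B9SupplySockB9P3ZdLetters (OpsZd)
open B9SupplySockB9P3ZdLettersOmega (Margin2)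
open B9SupplySockB9P3ZdAt (DictAt Prop6At InvAt GopAddAt LandauAt)
open B9SupplySockB9P3ZdBeta (SockB9P3D4β)
open B9SupplySockB9P3ZdGamma (SeesDom AvgAtγ)
open B9SupplySockB9P3ZdGammaInAk (CurvAtInAk sockB9P3D4γI_at)
open B9SupplySockB9P3ZdGammaInAkDpZd (withDpZd)
open B9Eq321LandauProjectionZd (opsLandau)
open B9Eq327GreenZd (LinearOnDomAt RegularInClassAt)
open B9SupplySockB9P3ZdGenuineGop (opsGenuine QQLinearAt QQLinearInClassAt PosDefInClassAt linearOnDomAt_opsGenuine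
  invAt_opsGenuine_of_posDef regularInClassAt_opsGenuine_of_posDef)
open B9SupplySockB9P3ZdAllLettersZd (opsAllZd curvAtInAk_opsAllZd landauAt_opsAllZd gopAddAt_opsAllZd)

variable (τ : 𝔸 →ₗ[ℂ] ℂ) [FiniteDimensional ℝ 𝔸] (L : ℕ) [Nontrivial 𝔸]
variable (ΛbP : ℕ → ℕ → Set (Site d × Fin d)) (ops₀ : ℝ → ZdIdx d L → ℕ → OpsZd d 𝔸) (M : ℝ) (i : ZdIdx d L) (m : ℕ)

variable {I : Type} (geo : I → B9.Geometry) (bg : I → B9.Backgrounds) (GA : ∀ i, B9.KernelFamily (geo i) (bg i))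
variable (mem : ℝ → ZdIdx d L → ℕ → I)
variable (ιCfg : ∀ (M : ℝ) (i : ZdIdx d L) (m : ℕ) (U₀ : Site d → Fin d → 𝔸ˣ),
  (∀ x κ, U₀ x κ ∈ unitaryUnits 𝔸) → (bg (mem M i m)).Cfg)
variable (ιLoc : ∀ (M : ℝ) (i : ZdIdx d L) (m : ℕ), (Site d → Fin d → 𝔸) → (geo (mem M i m)).Loc)

/-- ★ **`QQLinearInClassAt` FOR EDITION P under the level-`≥ 1` box clause** (every frame, all `c35 a₃`: unitarity suffices).
[cite: Balaban1985BackgroundPropagators, (3.16) p.393] -/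
theorem qqLinearInClassAt_withQQP₀ (hL : 2 ≤ L)
    (hbox : ∀ j, 1 ≤ j → j ≤ m → ∀ c ∈ ΛbP m j, ∀ x, InBox (loK L j c.1) (bondHiK L j c.1 c.2) x → x ∈ i.Ω (j - 1)) (c35 a₃ : ℝ) :
    QQLinearInClassAt bg mem ιCfg (withQQP τ L ΛbP ops₀) c35 a₃ M i m :=
  fun _ _ hU₀ _ _ _ => qqLinearAt_withQQP₀ τ L hL ΛbP ops₀ M i m hbox hU₀

/-- ★ **`Δ_a(U₀)` OF THE FOUR-LETTER RECORD IS THE RESTRICTION OF AN ℝ-LINEAR MAP AT EVERY UNITARY `U₀`** (finite `Ω₀`, `L ≥ 2`, the level-`≥ 1` box clause —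
print's class `cubeLamBP` included, §6): dag-n06-w4's `linearOnDomAt_opsGenuine` fed with §3.  The `hlin` input of `B9Thm311PosDefOpenZd.regularAtH_eventually_one_cube`
on ANY set of unitary backgrounds. [cite: Balaban1985BackgroundPropagators, (3.26) p.395 (Δ_a is a linear operator), (3.16) p.393] -/
theorem linearOnDomAt_opsAllZd_of_unitary₀ (hL : 2 ≤ L) (hΩ : (i.Ω 0).Finite)
    (hbox : ∀ j, 1 ≤ j → j ≤ m → ∀ c ∈ ΛbP m j, ∀ x, InBox (loK L j c.1) (bondHiK L j c.1 c.2) x → x ∈ i.Ω (j - 1))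
    {U₀ : Site d → Fin d → 𝔸ˣ} (hU₀ : ∀ x κ, U₀ x κ ∈ unitaryUnits 𝔸) :
    LinearOnDomAt i.η (opsAllZd τ L ΛbP ops₀ M i m) (i.Ω 0) U₀ :=
  linearOnDomAt_opsGenuine τ (withQQP τ L ΛbP ops₀) M i m hΩ U₀ (qqLinearAt_withQQP₀ τ L hL ΛbP ops₀ M i m hbox hU₀)

/-- ★ **`AvgAtγ` AT THE FOUR-LETTER RECORD under `LevelSepPP0`** (`2 ≤ d`, `2 ≤ L`, `|Re τ(x*y)| ≤ C_τ‖x‖‖y‖`; constant `q = qQ d L C_τ β_τ s`).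
[cite: Balaban1985BackgroundPropagators, (3.16) p.393; Balaban1985RegularSpaces, (1.56), (1.58) p.86] -/
theorem avgAtγ_opsAllZd₀ (hd : 2 ≤ d) (hL : 2 ≤ L) {Cτ : ℝ} (hCτ : ∀ x y : 𝔸, |(τ (star x * y)).re| ≤ Cτ * ‖x‖ * ‖y‖) {s : ℕ}
    (hlaw : LevelSepPP0 L m i.Ω ΛbP s) : AvgAtγ L (opsAllZd τ L ΛbP ops₀) (qQ d L Cτ (betaTau τ) s) ΛbP M i m := by
  intro U₀ hU₀ A hOn j hj x μ hb
  exact avgAtγ_withQQP₀ τ L hd hL hCτ ΛbP ops₀ M i m hlaw U₀ hU₀ A hOn j hj x μ hb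

/-- ★★ **`InvAt` AT THE FOUR-LETTER RECORD FROM THEOREM 3.11 AT THE MEMBER (PRINT'S CURRENCY), under the level-`≥ 1` box clause** (finite `Ω₀`, `2 ≤ L`).
[cite: Balaban1985BackgroundPropagators, (3.27) p.395, Thm 3.11 p.416; Balaban1985RegularSpaces, (1.58) p.86] -/
theorem invAt_opsAllZd_of_posDef₀ (hL : 2 ≤ L) (c35 a₃ : ℝ) (hΩ : (i.Ω 0).Finite)
    (hbox : ∀ j, 1 ≤ j → j ≤ m → ∀ c ∈ ΛbP m j, ∀ x, InBox (loK L j c.1) (bondHiK L j c.1 c.2) x → x ∈ i.Ω (j - 1))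
    (hpos : PosDefInClassAt τ bg mem ιCfg (opsAllZd τ L ΛbP ops₀) c35 a₃ M i m) :
    InvAt bg L mem ιCfg (opsAllZd τ L ΛbP ops₀) c35 a₃ M i m :=
  invAt_opsGenuine_of_posDef τ bg mem ιCfg (withQQP τ L ΛbP ops₀) c35 a₃ M i m hΩ
    (qqLinearInClassAt_withQQP₀ τ L ΛbP ops₀ M i m bg mem ιCfg hL hbox c35 a₃) hpos

/-- **`RegularInClassAt` for the three co-letter record from print's positivity, under the level-`≥ 1` box clause.**
[cite: Balaban1985BackgroundPropagators, Thm 3.11 p.416] -/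
theorem regularInClassAt_opsAllZd_of_posDef₀ (hL : 2 ≤ L) (c35 a₃ : ℝ) (hΩ : (i.Ω 0).Finite)
    (hbox : ∀ j, 1 ≤ j → j ≤ m → ∀ c ∈ ΛbP m j, ∀ x, InBox (loK L j c.1) (bondHiK L j c.1 c.2) x → x ∈ i.Ω (j - 1))
    (hpos : PosDefInClassAt τ bg mem ιCfg (opsAllZd τ L ΛbP ops₀) c35 a₃ M i m) :
    RegularInClassAt bg mem ιCfg (opsLandau τ (withDpZd (withQQP τ L ΛbP ops₀))) c35 a₃ M i m :=
  regularInClassAt_opsGenuine_of_posDef τ bg mem ιCfg (withQQP τ L ΛbP ops₀) c35 a₃ M i m hΩ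
    (qqLinearInClassAt_withQQP₀ τ L ΛbP ops₀ M i m bg mem ιCfg hL hbox c35 a₃) hpos

/-- ★★ **THE J-N06→N05 SUPPLIER ON THE FINITE-`Ω₀` (MARGIN) ROAD FOR THE FOUR-LETTER RECORD, EDITION P₀** — dag-n06-w4's `sockB9P3D4γI_at_opsAllZd`
VERBATIM with the class law `hlaw : LevelSepPP0 L m i.Ω ΛbP s` (so that print's class `cubeLamBP` is admissible, §6).  What the knit supplies is unchanged:
`DictAt`, `Prop6At`, `PosDefInClassAt` ([B9] Thm 3.11 at the member), `h33U` ([B9] Thm 3.3's block), `SeesDom`, `Margin2`, finiteness of `Ω₀`.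
[cite: Balaban1985BackgroundPropagators, Thm 3.3 p.399, Thm 3.11 p.416, (3.27) p.395; Balaban1985RegularSpaces, (1.58)–(1.59) p.86, Prop. 6 p.99] -/
theorem sockB9P3D4γI_at_opsAllZd₀ [NeZero L] (hd2 : 2 ≤ d) (hL : 2 ≤ L)
    (hτt : ∀ a b : 𝔸, τ (a * b) = τ (b * a)) (hτs : ∀ a : 𝔸, τ (star a) = starRingEnd ℂ (τ a))
    (hτp : ∀ a : 𝔸, a ≠ 0 → 0 < (τ (star a * a)).re) {Cτ : ℝ} (hCτ : ∀ x y : 𝔸, |(τ (star x * y)).re| ≤ Cτ * ‖x‖ * ‖y‖)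
    {c35 c₆ K₆ a₃ : ℝ} {M : ℝ} (hM1 : 1 ≤ M) (i : ZdIdx d L) (hMi : Margin2 i.Ω) (hΩ : (i.Ω 0).Finite) {m : ℕ}
    (hdict : DictAt geo bg GA L mem ιCfg ιLoc (opsAllZd τ L ΛbP ops₀) M i m) (hP6 : Prop6At bg L mem ιCfg c35 c₆ K₆ M i m)
    (hpos : PosDefInClassAt τ bg mem ιCfg (opsAllZd τ L ΛbP ops₀) c35 a₃ M i m)
    (hsee : SeesDom L m (i.Ω 0) ΛbP) {s : ℕ} (hlaw : LevelSepPP0 L m i.Ω ΛbP s)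
    (hK₆ : 0 < K₆) {B₀ δ₀ a₀ : ℝ} (hB₀ : 0 < B₀)
    (h33U : ∀ (α₀ : ℝ) (U₀ : Site d → Fin d → 𝔸ˣ) (hU₀ : ∀ x κ, U₀ x κ ∈ unitaryUnits 𝔸), 0 < α₀ → M * α₀ ≤ a₀ →
      (bg (mem M i m)).Reg335 c35 α₀ (ιCfg M i m U₀ hU₀) →
      B9.Ineq342_346_347 (GA (mem M i m)) B₀ δ₀ (ιCfg M i m U₀ hU₀)) :
    SockB9P3D4β (𝔸 := 𝔸) L (max 1 (2 * B₀ * max 1 (qQ d L Cτ (betaTau τ) s)))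
      ((20 * d + 2) * max 1 (2 * B₀ * max 1 (qQ d L Cτ (betaTau τ) s)))
      (min (1 / 16) (min (c₆ / M) (min (a₀ / (K₆ * M)) (min (a₃ / (K₆ * M)) (1 / (2 * B₀ * (14 * ((d - 1 : ℕ) : ℝ)) * M + 1))))))
      i.η m i.Ω i.Λs ΛbP := by
  have hL1 : 1 ≤ L := le_trans (by norm_num) hL
  have hq : 0 ≤ qQ d L Cτ (betaTau τ) s := by
    have hCτ0 : 0 ≤ Cτ := by
      have h := hCτ 1 1
      rw [star_one, one_mul, norm_one, mul_one, mul_one] at h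
      exact le_trans (abs_nonneg _) h
    have hβ : 0 ≤ betaTau τ := by
      unfold betaTau
      split_ifs
      · exact Finset.sum_nonneg fun i _ => mul_nonneg (norm_nonneg _) (norm_nonneg _)
      · exact le_rfl
    have hα : 0 ≤ alphaQ d L := (alphaQ_pos d hL1).le
    have hθ : 0 ≤ B7Prop5GeneralLevels.thetaGen d L (alphaQ d L) := by
      unfold B7Prop5GeneralLevels.thetaGen; positivity
    unfold qQ; positivity
  exact sockB9P3D4γI_at (geo := geo) (bg := bg) (GA := GA) (L := L) (mem := mem) (ιCfg := ιCfg) (ιLoc := ιLoc) (ops := opsAllZd τ L ΛbP ops₀)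
    hd2 hL1 hM1 i hMi hdict hP6
    (invAt_opsAllZd_of_posDef₀ τ L ΛbP ops₀ M i m bg mem ιCfg hL c35 a₃ hΩ (hbox0_of_levelSepPP0 hlaw) hpos)
    (curvAtInAk_opsAllZd τ L ΛbP ops₀ hL1 hM1 i m) (landauAt_opsAllZd τ L ΛbP ops₀ M i m bg mem ιCfg hτt hτs hτp c35 a₃ hΩ) ΛbP
    (avgAtγ_opsAllZd₀ τ L ΛbP ops₀ M i m hd2 hL hCτ hlaw) hsee hK₆ (by positivity) hq hB₀ h33U

end Record

/-! ## §6 Print's constraint-bond class of the cube member, `cubeLamBP`, obeys edition P₀'s law (collar `s = 1`) -/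

section Cube

open B7Prop1Explicit (e)
open B7Prop1Local (InBox loK bondHiK)
open B7Prop2Explicit (unitaryUnits)
open B8Ineq132 (Under BondTouches)
open B8Eq131Cubes (cube cube_anti)
open B8Eq131CubesAdmissible (cubeFam cubeFam_false_of_le)
open B8IdxB8LawsB (under_or_of_bondBox)
open B8CubeMemberLevelSep (inBox_inner_of_mem_cube_succ_of_under mem_cube_of_add_unit_mem_cube_succ levelSepPP_body_cubeLamBP')
open B8Ineq159FlatCubeMemberPrinted (cubeLamBP cubeLamBP_box_subset_pred)
open B9SupplySockB9P3ZdBeta (CrossB)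
open B9SupplySockB9P3ZdGamma (cubeLamBP' cubeLamBP'_of_ne_zero AvgAtγ)
open B8LeafModelZd (ZdIdx)
open B9SupplySockB9P3ZdLetters (OpsZd)
open B9Eq327GreenZd (LinearOnDomAt)
open B9SupplySockB9P3ZdAllLettersZd (opsAllZd)

/-- **THE LEVEL-`0` BOX OF A BOND IS ITS TWO ENDS**: `y ∈ [loK L 0 z, bondHiK L 0 z κ] ⟹ y = z ∨ y = z + e_κ` — the sense in which edition P's level-`0`
clause reads «both ends in `Ω₀`». [cite: Balaban1985Averaging, (127) p.37 («Q₀(U₀, ηA) = ηA»), p.24 (the boxes Bʲ(c₋) ∪ Bʲ(c₊))] -/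
theorem endpoints_of_inBox_zero {L : ℕ} (z : Site d) (κ : Fin d) {y : Site d} (hy : InBox (loK L 0 z) (bondHiK L 0 z κ) y) :
    y = z ∨ y = z + e κ := by
  by_cases hκ : y κ = z κ
  · left
    funext i
    by_cases hi : i = κ
    · subst hi; exact hκ
    · have h := hy i
      simp only [loK, bondHiK, pow_zero, one_mul, sub_self, add_zero, if_neg hi] at h
      omega
  · right
    funext i
    have h := hy i
    simp only [loK, bondHiK, pow_zero, one_mul, sub_self, add_zero] at h
    rw [B7Prop1Local.add_e_apply]
    by_cases hi : i = κ
    · subst hi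
      simp only [if_true] at h ⊢
      omega
    · simp only [if_neg hi] at h ⊢
      omega

/-- ★ **FOR `j < m` THE BOX SITES OF A LEVEL-`j` BOND OF PRINT'S CLASS AVOID `□_{j+1}`** (`m ≤ k`, `L ≥ 1`; every `j`, the level `0` with its crossing bonds
included): a box site lies in the block under an end of the bond, and a level-`j` block meeting `□_{j+1}` would put that end in `□_{j+1}^{(j)}` — which the
class excludes below the truncation level (`B8CubeMemberLevelSep.not_mem_cube_succ_of_mem_box_cubeLamBP'`'s proof, read for `cubeLamBP`).
[cite: Balaban1985RegularSpaces, (1.31) p.82, (1.68) p.88, p.98; Balaban1984PropagatorsII, (2.3) p.224] -/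
theorem not_mem_cube_succ_of_mem_box_cubeLamBP {L : ℕ} (hL : 1 ≤ L) (a : Site d) (M ρ : ℕ) {k m j : ℕ} (hmk : m ≤ k) (hjm : j < m)
    {c : Site d × Fin d} (hc : c ∈ cubeLamBP L a M ρ k m j) {y : Site d} (hy : InBox (loK L j c.1) (bondHiK L j c.1 c.2) y) :
    y ∉ cube L a M ρ k (j + 1) := by
  intro hy1
  have hjk : j < k := lt_of_lt_of_le hjm hmk
  obtain ⟨h1, h2⟩ := hc.2.2 hjm
  rcases under_or_of_bondBox j c.1 c.2 hy with h | h
  · exact h1 (inBox_inner_of_mem_cube_succ_of_under hL a M ρ hjk h hy1)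
  · exact h2 (inBox_inner_of_mem_cube_succ_of_under hL a M ρ hjk h hy1)

/-- ★ **CLAUSE 2 AT PRINT'S CLASS, COLLAR `s = 1`, EVERY LEVEL**: a unit bond at a box site of a level-`j` bond of `cubeLamBP … m j` (`j ≤ m ≤ k`,
`1 ≤ L ≤ ρ`) touches `□_{i'}` (`i' ≤ m`) only for `i' ≤ j + 1` — at `j = m` trivially; for `j < m` the box site is off `□_{j+1}` (previous lemma), and the collar
`ρ·L^{j+1} ≥ 1` between `∂□_{j+1}` and `□_{j+2}` forbids `i' ≥ j + 2` through the far end.  Level `0`: the ends of a crossing bond touch `□₀`, `□₁` at most.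
[cite: Balaban1985RegularSpaces, (1.28)–(1.31) pp.81–82, p.98 («a distance between boundaries of these cubes is equal to R₁M₁Lʲη»), (1.68) p.88; Balaban1984PropagatorsII, (2.1)–(2.3) p.224] -/
theorem le_succ_of_bondTouches_box_cubeLamBP {L : ℕ} (hL : 1 ≤ L) (a : Site d) (M : ℕ) {ρ : ℕ} (hρ : L ≤ ρ) {k m j : ℕ} (hmk : m ≤ k)
    (hjm : j ≤ m) {c : Site d × Fin d} (hc : c ∈ cubeLamBP L a M ρ k m j) {y : Site d}
    (hy : InBox (loK L j c.1) (bondHiK L j c.1 c.2) y) {i' : ℕ} (hi' : i' ≤ m) (μ : Fin d)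
    (ht : BondTouches (cubeFam false L a M ρ k i') y μ) : i' ≤ j + 1 := by
  by_contra hlt
  have hjm' : j < m := by omega
  have hi'k : i' ≤ k := hi'.trans hmk
  rw [cubeFam_false_of_le L a M ρ hi'k] at ht
  have hy1 : y ∉ cube L a M ρ k (j + 1) := not_mem_cube_succ_of_mem_box_cubeLamBP hL a M ρ hmk hjm' hc hy
  have hsub1 : cube L a M ρ k i' ⊆ cube L a M ρ k (j + 1) := cube_anti (by omega) hi'k
  have hsub2 : cube L a M ρ k i' ⊆ cube L a M ρ k (j + 1 + 1) := cube_anti (by omega) hi'k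
  rcases ht with h | h
  · exact hy1 (hsub1 h)
  · refine hy1 (mem_cube_of_add_unit_mem_cube_succ hL a M (hL.trans hρ) (by omega : j + 1 < k) (t := e μ) (fun i => ?_) (hsub2 h))
    simp only [e, Pi.single_apply]
    split_ifs <;> simp

/-- **THE LEVEL-`≥ 1` BOX CLAUSE AT PRINT'S CLASS**: the box of a level-`j` bond of `cubeLamBP … m j` (`1 ≤ j ≤ m ≤ k`, `1 ≤ L ≤ ρ`) lies in `□_{j−1} = Ω_{j−1}`
— dag-n05-c's `cubeLamBP_box_subset_pred` BY NAME, in the shape §3–§5 consume. [cite: Balaban1985RegularSpaces, (1.31) p.82, (1.131) p.99, p.98] -/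
theorem hbox0_cubeLamBP {L : ℕ} (hL : 1 ≤ L) (a : Site d) (M : ℕ) {ρ : ℕ} (hρ : L ≤ ρ) {k m : ℕ} (hmk : m ≤ k) :
    ∀ j, 1 ≤ j → j ≤ m → ∀ c ∈ cubeLamBP L a M ρ k m j, ∀ x, InBox (loK L j c.1) (bondHiK L j c.1 c.2) x →
      x ∈ cubeFam false L a M ρ k (j - 1) := by
  intro j hj1 hjm c hc x hx
  rw [cubeFam_false_of_le L a M ρ (by omega : j - 1 ≤ k)]
  exact cubeLamBP_box_subset_pred hL a M hρ hj1 hmk hc x hx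

/-- ★★★ **PRINT'S CLASS OF THE CUBE MEMBER OBEYS EDITION P₀'s LAW, COLLAR `s = 1`**: `LevelSepPP0 L m (cubeFam false L a M ρ k) (cubeLamBP L a M ρ k) 1` at
every truncation `m ≤ k` (`1 ≤ L ≤ ρ`) — at the levels `j ≥ 1` print's class IS the split class (`cubeLamBP'_of_ne_zero`) and the landed body
`levelSepPP_body_cubeLamBP'` applies; at level `0` only the collar clause is asked, and it holds for the crossing bonds too.  The `hlaw` of
`avgAtP_withQQP₀ ∕ avgAtγ_withQQP₀ ∕ sockB9P3D4γI_at_opsAllZd₀` at print's class. [cite: Balaban1985RegularSpaces, (1.5) p.77, (1.28)–(1.31) pp.81–82, (1.68) p.88, (1.131) p.99, p.98; Balaban1984PropagatorsII, (2.1)–(2.3) p.224; Balaban1985Averaging, (127) p.37] -/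
theorem levelSepPP0_cubeLamBP {L : ℕ} (hL : 1 ≤ L) (a : Site d) (M : ℕ) {ρ : ℕ} (hρ : L ≤ ρ) {k m : ℕ} (hmk : m ≤ k) :
    LevelSepPP0 L m (cubeFam false L a M ρ k) (cubeLamBP L a M ρ k) 1 := by
  intro j hjm c hc y hy
  refine ⟨fun hj1 => ?_, fun i' hi' μ ht => le_succ_of_bondTouches_box_cubeLamBP hL a M hρ hmk hjm hc hy hi' μ ht⟩
  rw [cubeFam_false_of_le L a M ρ (by omega : j - 1 ≤ k)]
  exact cubeLamBP_box_subset_pred hL a M hρ hj1 hmk hc y hy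

/-- The member presentation: at an index `i` with `i.Ω = cubeFam false L a M ρ i.k`, `LevelSepPP0 L m i.Ω (cubeLamBP L a M ρ i.k) 1` for every `m ≤ i.k`.
[cite: Balaban1985RegularSpaces, (1.131) p.99, (1.31) p.82] -/
theorem levelSepPP0_cubeLamBP_of_eq {L : ℕ} (hL : 1 ≤ L) (i : ZdIdx d L) (a : Site d) (M : ℕ) {ρ : ℕ} (hρ : L ≤ ρ)
    (hΩ : i.Ω = cubeFam false L a M ρ i.k) {m : ℕ} (hm : m ≤ i.k) :
    LevelSepPP0 L m i.Ω (cubeLamBP L a M ρ i.k) 1 := by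
  rw [hΩ]
  exact levelSepPP0_cubeLamBP hL a M hρ hm

/-- The level-`≥ 1` box clause at the member presentation. [cite: Balaban1985RegularSpaces, (1.131) p.99, (1.31) p.82] -/
theorem hbox0_cubeLamBP_of_eq {L : ℕ} (hL : 1 ≤ L) (i : ZdIdx d L) (a : Site d) (M : ℕ) {ρ : ℕ} (hρ : L ≤ ρ)
    (hΩ : i.Ω = cubeFam false L a M ρ i.k) {m : ℕ} (hm : m ≤ i.k) :
    ∀ j, 1 ≤ j → j ≤ m → ∀ c ∈ cubeLamBP L a M ρ i.k m j, ∀ x, InBox (loK L j c.1) (bondHiK L j c.1 c.2) x → x ∈ i.Ω (j - 1) := by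
  rw [hΩ]
  exact hbox0_cubeLamBP hL a M hρ hm

/-- **SCOPE CERTIFICATE: EDITION P's LAW FAILS AT PRINT'S CLASS AS SOON AS A LEVEL-`0` CROSSING BOND IS A CLASS BOND** — for any `Ω`, `s`, `m`: if some
`c ∈ ΛbP m 0` has an end outside `Ω 0`, then `¬ LevelSepPP L m Ω ΛbP s` (the level-`0` clause asks both ends in `Ω₀`).  With n05-c's
`mem_cubeLamBP_zero_of_crossB` this is the located defect (LOCATED-SELF-5) in kernel form. [cite: Balaban1985RegularSpaces, p.77 (bond convention), (1.31) p.82; Balaban1984PropagatorsII, (2.3) p.224 («Λ₀ = Ω₁ᶜ»)] -/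
theorem not_levelSepPP_of_crossing {L m : ℕ} {Ω : ℕ → Set (Site d)} {ΛbP : ℕ → ℕ → Set (Site d × Fin d)} {s : ℕ}
    {c : Site d × Fin d} (hc : c ∈ ΛbP m 0) (hout : c.1 ∉ Ω 0 ∨ c.1 + e c.2 ∉ Ω 0) : ¬ LevelSepPP L m Ω ΛbP s := by
  intro hlaw
  have hlo : InBox (loK L 0 c.1) (bondHiK L 0 c.1 c.2) c.1 := by
    intro i
    simp only [loK, bondHiK, pow_zero, one_mul, sub_self, add_zero]
    split_ifs <;> omega
  have hhi : InBox (loK L 0 c.1) (bondHiK L 0 c.1 c.2) (c.1 + e c.2) := by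
    intro i
    rw [B7Prop1Local.add_e_apply]
    simp only [loK, bondHiK, pow_zero, one_mul, sub_self, add_zero]
    split_ifs <;> omega
  rcases hout with h | h
  · exact h (by simpa using (hlaw 0 (Nat.zero_le m) c hc c.1 hlo).1)
  · exact h (by simpa using (hlaw 0 (Nat.zero_le m) c hc (c.1 + e c.2) hhi).1)

/-- **Edition P's law fails at `cubeLamBP` whenever `□₀` has a crossing bond** (`L ≥ 1`, `k ≥ 1`, `ρ ≥ 1`; any `m`, `s`) — the defect this file cures.
[cite: Balaban1985RegularSpaces, p.77 (bond convention), (1.131) p.99; Balaban1984PropagatorsII, (2.3) p.224] -/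
theorem not_levelSepPP_cubeLamBP_of_crossB {L : ℕ} (hL : 1 ≤ L) (a : Site d) (M : ℕ) {ρ : ℕ} (hρ : 1 ≤ ρ) {k : ℕ} (hk : 1 ≤ k) (m s : ℕ)
    {b : Site d × Fin d} (hb : CrossB (cubeFam false L a M ρ k 0) b) :
    ¬ LevelSepPP L m (cubeFam false L a M ρ k) (cubeLamBP L a M ρ k) s := by
  have hc := B8Ineq159FlatCubeMemberPrinted.mem_cubeLamBP_zero_of_crossB hL a M hρ hk m hb
  refine not_levelSepPP_of_crossing (c := b) hc ?_
  -- a crossing bond has exactly one end in `□₀`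
  obtain ⟨-, hnot⟩ := hb
  by_cases h1 : b.1 ∈ cubeFam false L a M ρ k 0
  · exact Or.inr fun h2 => hnot ⟨h1, h2⟩
  · exact Or.inl h1

variable (τ : 𝔸 →ₗ[ℂ] ℂ) [FiniteDimensional ℝ 𝔸] [Nontrivial 𝔸]

/-- ★★ **THE AVERAGING BINDER FOR THE GENUINE LETTER AT PRINT'S CLASS OF THE CUBE MEMBER, BY NAME** (γ currency; `2 ≤ d`, `2 ≤ L ≤ ρ`, `m ≤ k`,
`|Re τ(x*y)| ≤ C_τ‖x‖‖y‖`; constant `qQ d L C_τ β_τ 1`): `AvgAtγ L (withQQP τ L (cubeLamBP …) ops₀) (qQ d L C_τ β_τ 1) (cubeLamBP …) M i m` at every index `i`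
presenting the cube tower. [cite: Balaban1985BackgroundPropagators, (3.16) p.393; Balaban1985RegularSpaces, (1.56), (1.58) p.86, (1.131) p.99] -/
theorem avgAtγ_withQQP_cubeLamBP (hd : 2 ≤ d) {L : ℕ} (hL : 2 ≤ L)
    {Cτ : ℝ} (hCτ : ∀ x y : 𝔸, |(τ (star x * y)).re| ≤ Cτ * ‖x‖ * ‖y‖)
    (ops₀ : ℝ → ZdIdx d L → ℕ → OpsZd d 𝔸) (M : ℝ) (i : ZdIdx d L) {a : Site d} {Mc ρ : ℕ} (hρ : L ≤ ρ)
    (hΩ : i.Ω = cubeFam false L a Mc ρ i.k) {m : ℕ} (hm : m ≤ i.k) :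
    AvgAtγ L (withQQP τ L (cubeLamBP L a Mc ρ i.k) ops₀) (qQ d L Cτ (betaTau τ) 1) (cubeLamBP L a Mc ρ i.k) M i m :=
  avgAtγ_withQQP₀ τ L hd hL hCτ _ ops₀ M i m (levelSepPP0_cubeLamBP_of_eq (le_trans (by norm_num) hL) i a Mc hρ hΩ hm)

/-- ★★ **`AvgAtγ` FOR THE FOUR-LETTER RECORD AT PRINT'S CLASS OF THE CUBE MEMBER, BY NAME.** [cite: Balaban1985BackgroundPropagators, (3.16) p.393; Balaban1985RegularSpaces, (1.56), (1.58) p.86, (1.131) p.99] -/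
theorem avgAtγ_opsAllZd_cubeLamBP (hd : 2 ≤ d) {L : ℕ} (hL : 2 ≤ L)
    {Cτ : ℝ} (hCτ : ∀ x y : 𝔸, |(τ (star x * y)).re| ≤ Cτ * ‖x‖ * ‖y‖)
    (ops₀ : ℝ → ZdIdx d L → ℕ → OpsZd d 𝔸) (M : ℝ) (i : ZdIdx d L) {a : Site d} {Mc ρ : ℕ} (hρ : L ≤ ρ)
    (hΩ : i.Ω = cubeFam false L a Mc ρ i.k) {m : ℕ} (hm : m ≤ i.k) :
    AvgAtγ L (opsAllZd τ L (cubeLamBP L a Mc ρ i.k) ops₀) (qQ d L Cτ (betaTau τ) 1) (cubeLamBP L a Mc ρ i.k) M i m :=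
  avgAtγ_opsAllZd₀ τ L _ ops₀ M i m hd hL hCτ (levelSepPP0_cubeLamBP_of_eq (le_trans (by norm_num) hL) i a Mc hρ hΩ hm)

/-- ★★ **`Δ_a(U₀)` OF THE FOUR-LETTER RECORD AT PRINT'S CLASS IS ℝ-LINEAR ON `E(□₀)` AT EVERY UNITARY `U₀`** (finite `□₀`, `2 ≤ L ≤ ρ`, `m ≤ k`) — the `hlin`
input of dag-n06-w4's `B9Thm311PosDefOpenZd.regularAtH_eventually_one_cube` on ANY set `𝒰` of unitary backgrounds (in particular the member's own
regime `{U₀ unitary ∧ Reg17 L m i.Ω (α_Q∕L²) U₀}`, gauge-invariant and containing its small-field class). [cite: Balaban1985BackgroundPropagators, (3.26) p.395, (3.16) p.393, Thm 3.11 p.416] -/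
theorem linearOnDomAt_opsAllZd_cubeLamBP {L : ℕ} (hL : 2 ≤ L) (ops₀ : ℝ → ZdIdx d L → ℕ → OpsZd d 𝔸) (M : ℝ) (i : ZdIdx d L)
    {a : Site d} {Mc ρ : ℕ} (hρ : L ≤ ρ) (hΩ : i.Ω = cubeFam false L a Mc ρ i.k) (hfin : (i.Ω 0).Finite) {m : ℕ} (hm : m ≤ i.k)
    {U₀ : Site d → Fin d → 𝔸ˣ} (hU₀ : ∀ x κ, U₀ x κ ∈ unitaryUnits 𝔸) :
    LinearOnDomAt i.η (opsAllZd τ L (cubeLamBP L a Mc ρ i.k) ops₀ M i m) (i.Ω 0) U₀ :=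
  linearOnDomAt_opsAllZd_of_unitary₀ τ L _ ops₀ M i m hL hfin (hbox0_cubeLamBP_of_eq (le_trans (by norm_num) hL) i a Mc hρ hΩ hm) hU₀

end Cube

end Literature.MathematicalPhysics.QuantumFieldTheory.Balaban1983to89.B9Eq316AveragingTransposeZdLevelZero

end
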